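import Literature.NumberTheory.Rogawski1990.ArchOrbFamGExtFaceJetBounds    -- ★ p851037∕p851101 (LH3-p02 (g4)) (B2): §1 `norm_iteratedFDeriv_comp_clm_le_of_isOpen` (pull-back along a CLM on an open set)
import Literature.Analysis.Calculus.IteratedFDerivBlockReaderBounds         -- ★ (F0P3a-p08 (g23)) (E1): `exists_forall_norm_iteratedFDeriv_lineReader_le_of_uniform_on` (the filter-free corner reader bound, line form); brings ★ (B2a)
import HarnessLib

/-!
# (I₁) AT A CROSS-PLACE CORNER — the reader calculus of the corner, filter-free: jets of a reader on a product region `(S ∩ Q) × (T ∩ T₀)` from normal-jet bounds of the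
# family uniform there; such bounds for `C^∞`-BOUNDED (not compact, not continuous) families via `ℓ^∞`; slices of a jointly bounded function; punctured-interval upgrade
# (Varadarajan 1977 I §1.12; Bouaziz 1994 §3.1–3.2; Hörmander ALPDO I §1.1, §2.1)

Topic `NumberTheory/Rogawski1990`; namespace `Literature.Analysis.Calculus` (generic throughout).  THEOREMS ONLY (no `def`, no instance, no notation, no axiom, no named fact,
no `sorry`).  Cell `pub/hodgecm-mathlib`, crux H413 (`stmt-HodgeConjecture-24833`), F0∕P3c line LH3 (closer stub `stub_N9`, DIRECT ROAD), LETTER L1 clause (I₁) of ★ `ArchHcSmoothOneSided`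
for `orbFamGExt`: brick **(X3) «NESTED READERS AT A CORNER» — CORE** of the cross-place-corner road (X1)–(X3) (organ O-L1c-X′ of leaf `F0_P3c_StubN9Direct` v5; (I₁) spec-owner
LH7-p04 (g4) «= (X3) signature-first» 2026-09-02T10:48:47Z), seat F0P3a-p02 (g21); sequel of ★ (X1) `ArchOrbFamGExtMultiWallJetBounds`.  Count-neutral.

THE MATHEMATICS.  At a cross-place corner `x` (one-wall configurations at `m ≥ 2` compact places, no scalar corner) the `m`-block descent (X2) writes the twisted family, off the corner
walls near `x`, as a smooth cofactor times an ITERATED reader: with `ψ₁, …, ψ_m` the normal coordinates and `q` the transversal ones,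
`H (q, ψ_m, …, ψ₁) = Φ₁ (X₁ ↦ Φ₂ (X₂ ↦ ⋯ f (q, X₁, …, X_m) ⋯) ψ₂) ψ₁`, each `Φ_k` a rank-one elliptic orbital functional (★ (ELL-∞-UNIF)).  Peeling the OUTERMOST functional, `H` is a
reader `z ↦ Φ₁ (g z.1) z.2` over the family `g (q, ψ_m, …, ψ₂) := X₁ ↦ (inner iterated reader)`, whose parameter set `Q′ = Q ×ˢ {ψ_m ≠ 0} ×ˢ ⋯ ×ˢ {ψ₂ ≠ 0}` is OPEN but does NOT contain
the corner parameter `(q₀, 0, …, 0)`: the family is smooth on `Q′` and merely `C^∞`-BOUNDED (all `X₁`-jets bounded, one compact support — no continuity in the parameter up to the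
inner walls) over `S ∩ Q′`, `S` a neighbourhood of the corner parameter — by the inner step.  Since every such bound lives on a FIXED punctured interval of each normal coordinate,
the whole calculus is written filter-free, on product regions `(S ∩ Q) ×ˢ (T ∩ T₀)`:
* §1 **`bddAbove_norm_iteratedFDeriv_reader_image_of_uniform_on`** — the CORNER form of ★ §C in the `BddAbove`-image currency of ★ (X1): same reader data
  `(Φ, Adm, D, hcl, h1, h2)` on the open `Q ×ˢ T`, but the normal-jet hypothesis `hbd` and the conclusion are UNIFORM bounds on the product region `(S ∩ Q) ×ˢ (T ∩ T₀)` for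
  arbitrary sets `S ⊆ P`, `T₀ ⊆ ℝ` (no base point, no compactness, no filter); the bound itself is ★ `exists_forall_norm_iteratedFDeriv_lineReader_le_of_uniform_on` (F0P3a-p08
  (g23), the `V = ℝ` line of ★ (E1) `…blockReader…` — landed first with this seat's statement text, so it is IMPORTED here, not restated);
* §2 **`exists_forall_norm_iteratedDeriv_le_of_uniform_bounds_on`** — the `hbd` of §1 for a `C^∞`-BOUNDED family: if `F : (M → E) → ℝ → E` satisfies the (ELL-∞-UNIF)-type
  hypothesis on the fixed set `T₀` at `E′ := ℓ^∞(J, E)` (`hunif`: for every `G ∈ C_c^∞(M, E′)` one `B` with `‖(F (ℓ ∘ G))⁽ⁿ⁾ ψ‖ ≤ ‖ℓ‖ · B` for `ψ ∈ T₀` and all CLMs `ℓ`), then for ANY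
  index type `J` and any family `g : J → M → E` of smooth functions supported in one compact `C` with jets of every order bounded uniformly in `j`:
  `∃ B, ∀ j, ∀ ψ ∈ T₀, ‖(F (g j))⁽ⁿ⁾ ψ‖ ≤ B` (★ (B2a) packages the family as ONE `G ∈ C_c^∞(M, ℓ^∞(J, E))` with `ev_j ∘ G = g j`, `‖ev_j‖ ≤ 1`); the `𝓝[≠] 0`-eventual form
  `…_eventually_…` and the `S ∩ Q`-indexed forms `…_on_inter` in the exact `hbd` shape of §1.  (★ §A `…_le_of_contDiff_family` is the COMPACT-parameter jointly-smooth case; this is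
  the bounded-parameter case the corner needs.)
* §3 SLICES **`norm_iteratedFDeriv_slice_le_of_isOpen`**, **`exists_forall_slice_bounds_of_bddAbove`**, `contDiff_slice_of_contDiffOn_prod_univ`, `tsupport_slice_subset` — for `R`
  of class `Cᵐ` on an open `O ⊆ P × M` the partial jet of the slice `X ↦ R (q, X)` is bounded by the full jet `‖Dᵐ R (q, X)‖` (chain rule along `inr`, `‖inr‖ ≤ 1`, ★ (B2) §1), so
  jointly bounded jets of the inner reader on `S ×ˢ C` make the slices `{X ↦ R (s, X)}_{s ∈ S}` a `C^∞`-bounded family on `C` — the input of §2;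
* §4 UPGRADE **`exists_forall_norm_le_of_eventually_of_continuousOn`** ∕ **`…_comp_clm_le_…`** — an `𝓝[≠] 0`-eventual bound plus continuity on `T₀ ∖ {0}` (`T₀` compact) is a
  bound on ALL of `T₀ ∖ {0}`, also in the CLM-uniform form `‖ℓ (u ψ)‖ ≤ ‖ℓ‖ · B`: turns ★ (ELL-∞-UNIF) §4 (eventual) + ★ §2∕§3 (smooth on the punctured interval `Ioo (-1) 1 ∖ {0}`,
  `(F (ℓ ∘ G))⁽ⁿ⁾ = ℓ ∘ (F′ G)⁽ⁿ⁾` there) into the fixed-interval `hunif` of §2 — brick (X3-rk1), rank-one frame, next file.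
ROAD MAP of O-L1c-X′ after this file (tokens fixed here): (X3-rk1) the fixed-interval (ELL-∞-UNIF) + reader data `(Φ₁, Adm, D, h1, h2)` over families smooth on an OPEN parameter
set (twin of ★ (B-par) `ArchRankOneOrbitalFamilyParam` with `ContDiffOn ℝ ∞ (uncurry Θ) (Q′ ×ˢ univ)`); (X2) the `m`-block descent box at a cross-place corner (★ p851016 twin:
★ `exists_isCompact_mul_arch_of_places` fed by ★ `uniformlyProper_circleDiagonal_of_ne` at every corner place, an `m`-place (M-UNFOLD), ★ `integral_descConj_eq_smul_integral_of_block`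
with `B := Π_k U(J_{w_k})`, Fubini); (X3-asm) the peeling induction over the corner places, ending in ★ (X1) `…_of_multiWallProductModel_cube`.
HONEST LABEL: generic calculus, no analysis of orbital integrals, no descent; the compact-SCALAR corners (O-L1d «HC-CENTRAL») are PRINT; HC_CM is proved only modulo the 7 printed
citations (2 remaining: hLiu418 = `stmt-HodgeConjecture-24832`, h413 = `stmt-HodgeConjecture-24833`) until rung 0 closes; this file moves no row of the books.

## References
* [Varadarajan1977] V. S. Varadarajan, *Harmonic Analysis on Real Reductive Groups*, LNM 576 (1977), Part I §1.12 (`'F_f`: bounded derivatives on `T_{in-reg}`), Part I §3.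
* [Bouaziz1994IntegralesOrbitales] A. Bouaziz, *Intégrales orbitales sur les groupes de Lie réductifs*, Ann. Sci. ÉNS 27 (1994), §3.1 (I₁)–(I₂) p. 579, §3.2 p. 580.
* [HormanderALPDO1] L. Hörmander, *The Analysis of Linear Partial Differential Operators I*, 2nd ed. (1990), §1.1 Thm. 1.1.8, (1.1.9); §2.1 (bounded sets of test functions).
* [Shelstad1979] D. Shelstad, *Characters and inner forms of a quasi-split group over ℝ*, Compositio Math. 39 (1979), §4 pp. 22–25.
-/

set_option autoImplicit false

noncomputable section

open Set Filter Topology Function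
open scoped ContDiff ENNReal

namespace Literature.Analysis.Calculus

/-! ## §1 The corner twin of §C (★ (E1) line form, F0P3a-p08): reader jets on a product region, `BddAbove`-image currency -/

section CornerReader

variable {P : Type*} [NormedAddCommGroup P] [NormedSpace ℝ P] [FiniteDimensional ℝ P] {Y W' F : Type*} [NormedAddCommGroup F] [NormedSpace ℝ F]

/-- **JET BOUNDS OF A READER ON A PRODUCT REGION FROM NORMAL-JET BOUNDS UNIFORM ON THAT REGION (filter-free corner form, `BddAbove`-image currency).**  Readers
`z ↦ Φ (g z.1) z.2` of an admissible class `Adm` (closed under the transversal derivatives `D v`), smooth on `Q ×ˢ T` ((H1)) with (H2) `∂_{(v,0)} Φ(g ·) = Φ(D v g ·)`, `Q` and `T`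
OPEN; IF for every admissible `g′` and every order `a` the normal jets `(Φ (g′ q))⁽ᵃ⁾ ψ` are bounded UNIFORMLY over `q ∈ S ∩ Q`, `ψ ∈ T ∩ T₀` (`hbd`; for a `C^∞`-bounded family
this is §2 — `S` is typically a compact neighbourhood of a corner parameter NOT in `Q`, `T₀` a compact interval around the wall `ψ = 0 ∉ T`), THEN every jet of the reader of an
admissible `g` is bounded on `(S ∩ Q) ×ˢ (T ∩ T₀)` — ★ `exists_forall_norm_iteratedFDeriv_lineReader_le_of_uniform_on` (F0P3a-p08 (g23); the corner twin of ★ §C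
`exists_nhds_bddAbove_norm_iteratedFDeriv_reader_of_uniform`) read as the `hH₂b` currency of ★ (X1) `…_of_multiWallProductModel` on `O₂ := (S ∩ Q) ×ˢ (T ∩ T₀)`-type regions.
[cite: HormanderALPDO1, §1.1 Thm. 1.1.8, (1.1.9)] [cite: Bouaziz1994IntegralesOrbitales, §3.1 (I₁)–(I₂) p. 579; §3.2 p. 580] [cite: Varadarajan1977, Part I §1.12] -/
theorem bddAbove_norm_iteratedFDeriv_reader_image_of_uniform_on {Q : Set P} (hQ : IsOpen Q) {T : Set ℝ} (hT : IsOpen T) (Φ : (Y → W') → ℝ → F)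
    (Adm : (P → Y → W') → Prop) (D : P → (P → Y → W') → (P → Y → W')) (hcl : ∀ g, Adm g → ∀ v, Adm (D v g))
    (h1 : ∀ g, Adm g → ContDiffOn ℝ ∞ (fun z : P × ℝ => Φ (g z.1) z.2) (Q ×ˢ T))
    (h2 : ∀ g, Adm g → ∀ (v : P) (z : P × ℝ), z ∈ Q ×ˢ T → fderiv ℝ (fun z : P × ℝ => Φ (g z.1) z.2) z (v, 0) = Φ (D v g z.1) z.2)
    (S : Set P) (T₀ : Set ℝ)
    (hbd : ∀ g, Adm g → ∀ a : ℕ, ∃ B : ℝ, ∀ q ∈ S ∩ Q, ∀ ψ ∈ T ∩ T₀, ‖iteratedDeriv a (Φ (g q)) ψ‖ ≤ B)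
    (g : P → Y → W') (hg : Adm g) (k : ℕ) :
    BddAbove ((fun z => ‖iteratedFDeriv ℝ k (fun z : P × ℝ => Φ (g z.1) z.2) z‖) '' ((S ∩ Q) ×ˢ (T ∩ T₀))) := by
  obtain ⟨B, hB⟩ := exists_forall_norm_iteratedFDeriv_lineReader_le_of_uniform_on hQ hT Φ Adm D hcl h1 h2 S T₀ hbd g hg k
  exact ⟨B, forall_mem_image.2 hB⟩

end CornerReader

/-! ## §2 The `hbd` of §1 for a `C^∞`-BOUNDED family: one bound over an arbitrary index set via `ℓ^∞` (★ (B2a) + the (ELL-∞-UNIF)-type hypothesis) -/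

section BoundedFamily

variable {M E : Type} [NormedAddCommGroup M] [NormedSpace ℝ M] [NormedAddCommGroup E] [NormedSpace ℝ E]

/-- **UNIFORM NORMAL-JET BOUNDS OVER A `C^∞`-BOUNDED FAMILY ON A FIXED SET OF NORMAL PARAMETERS (no topology on the index set).**  Let `F : (M → E) → ℝ → E` satisfy the
(ELL-∞-UNIF)-type hypothesis on `T₀` at `E′ := ℓ^∞(J, E)`: for every `G ∈ C_c^∞(M, E′)` one constant `B` bounds `‖(F (ℓ ∘ G))⁽ⁿ⁾ ψ‖ ≤ ‖ℓ‖ · B` for `ψ ∈ T₀` and all CLMs `ℓ : E′ →L E`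
(`hunif`; §4 turns ★ `RankOneCasimir.exists_forall_eventually_norm_iteratedDeriv_orbitalIntegral_comp_clm_le` into this on a compact punctured interval).  Then for every family
`g : J → M → E` of smooth functions supported in ONE compact `C` with jets of EVERY order bounded on `C` uniformly in `j` («`C^∞`-bounded»):
`∃ B, ∀ j, ∀ ψ ∈ T₀, ‖(F (g j))⁽ⁿ⁾ ψ‖ ≤ B`.  Proof: ★ (B2a) `exists_contDiff_hasCompactSupport_lpInfty_of_bounds_on` packages the family as ONE `G ∈ C_c^∞(M, ℓ^∞(J, E))` with
`ev_j ∘ G = g j`, `‖ev_j‖ ≤ 1`; apply `hunif`. [cite: HormanderALPDO1, §2.1] [cite: Bouaziz1994IntegralesOrbitales, §3.1 (I₁)–(I₂) p. 579] [cite: Varadarajan1977, Part I §1.12] -/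
theorem exists_forall_norm_iteratedDeriv_le_of_uniform_bounds_on {J : Type} (F : (M → E) → ℝ → E) (n : ℕ) (T₀ : Set ℝ)
    (hunif : ∀ G : M → lp (fun _ : J => E) ⊤, ContDiff ℝ ∞ G → HasCompactSupport G →
      ∃ B : ℝ, ∀ ψ ∈ T₀, ∀ ℓ : lp (fun _ : J => E) ⊤ →L[ℝ] E, ‖iteratedDeriv n (F (fun X => ℓ (G X))) ψ‖ ≤ ‖ℓ‖ * B)
    (g : J → M → E) (hg : ∀ j, ContDiff ℝ ∞ (g j)) {C : Set M} (hC : IsCompact C) (hsupp : ∀ j, tsupport (g j) ⊆ C)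
    (hbd : ∀ m : ℕ, ∃ B : ℝ, ∀ j, ∀ X ∈ C, ‖iteratedFDeriv ℝ m (g j) X‖ ≤ B) :
    ∃ B : ℝ, ∀ j, ∀ ψ ∈ T₀, ‖iteratedDeriv n (F (g j)) ψ‖ ≤ B := by
  obtain ⟨G, hG, hGs, hGc, -, hev⟩ := exists_contDiff_hasCompactSupport_lpInfty_of_bounds_on g hg hC hsupp hbd
  obtain ⟨B, hB⟩ := hunif G hGs hGc
  refine ⟨max B 0, fun j ψ hψ => ?_⟩
  obtain ⟨ℓ, hℓ, hℓG⟩ := hev j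
  have hfun : (fun X => ℓ (G X)) = g j := funext fun X => by rw [hℓG X]
  have h := hB ψ hψ ℓ
  rw [hfun] at h
  exact h.trans ((mul_le_mul_of_nonneg_left (le_max_left B 0) (norm_nonneg ℓ)).trans
    (by nlinarith [hℓ, le_max_right B 0, norm_nonneg ℓ]))

/-- **The `𝓝[≠] 0`-eventual form** (hypothesis and conclusion on ONE punctured neighbourhood of the wall, as ★ (ELL-∞-UNIF) §4 is stated): same proof.
[cite: HormanderALPDO1, §2.1] [cite: Bouaziz1994IntegralesOrbitales, §3.1 (I₁)–(I₂) p. 579] -/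
theorem exists_forall_eventually_norm_iteratedDeriv_le_of_uniform_bounds {J : Type} (F : (M → E) → ℝ → E) (n : ℕ)
    (hunif : ∀ G : M → lp (fun _ : J => E) ⊤, ContDiff ℝ ∞ G → HasCompactSupport G →
      ∃ B : ℝ, ∀ᶠ ψ in 𝓝[≠] (0 : ℝ), ∀ ℓ : lp (fun _ : J => E) ⊤ →L[ℝ] E, ‖iteratedDeriv n (F (fun X => ℓ (G X))) ψ‖ ≤ ‖ℓ‖ * B)
    (g : J → M → E) (hg : ∀ j, ContDiff ℝ ∞ (g j)) {C : Set M} (hC : IsCompact C) (hsupp : ∀ j, tsupport (g j) ⊆ C)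
    (hbd : ∀ m : ℕ, ∃ B : ℝ, ∀ j, ∀ X ∈ C, ‖iteratedFDeriv ℝ m (g j) X‖ ≤ B) :
    ∃ B : ℝ, ∀ᶠ ψ in 𝓝[≠] (0 : ℝ), ∀ j, ‖iteratedDeriv n (F (g j)) ψ‖ ≤ B := by
  obtain ⟨G, hG, hGs, hGc, -, hev⟩ := exists_contDiff_hasCompactSupport_lpInfty_of_bounds_on g hg hC hsupp hbd
  obtain ⟨B, hB⟩ := hunif G hGs hGc
  refine ⟨max B 0, ?_⟩
  filter_upwards [hB] with ψ hψ j
  obtain ⟨ℓ, hℓ, hℓG⟩ := hev j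
  have hfun : (fun X => ℓ (G X)) = g j := funext fun X => by rw [hℓG X]
  have h := hψ ℓ
  rw [hfun] at h
  exact h.trans ((mul_le_mul_of_nonneg_left (le_max_left B 0) (norm_nonneg ℓ)).trans
    (by nlinarith [hℓ, le_max_right B 0, norm_nonneg ℓ]))

/-- **The `S ∩ Q`-indexed form on a fixed normal set** — the exact `hbd` shape of §1 `exists_forall_norm_iteratedFDeriv_reader_le_of_uniform_on` for ONE member and order: a parameter
family `g′ : P → M → E` whose members over `q ∈ S ∩ Q` are smooth, supported in one compact `C` and `C^∞`-bounded there, and `F` with `hunif` on `T₀` at `E′ := ℓ^∞(↥(S ∩ Q), E)`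
⇒ `∃ B, ∀ q ∈ S ∩ Q, ∀ ψ ∈ T₀, ‖(F (g′ q))⁽ⁿ⁾ ψ‖ ≤ B`. [cite: HormanderALPDO1, §2.1] [cite: Bouaziz1994IntegralesOrbitales, §3.1 (I₁)–(I₂) p. 579] -/
theorem exists_forall_norm_iteratedDeriv_le_of_uniform_bounds_on_inter {P : Type} (F : (M → E) → ℝ → E) (n : ℕ) (S Q : Set P) (T₀ : Set ℝ)
    (hunif : ∀ G : M → lp (fun _ : ↥(S ∩ Q) => E) ⊤, ContDiff ℝ ∞ G → HasCompactSupport G →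
      ∃ B : ℝ, ∀ ψ ∈ T₀, ∀ ℓ : lp (fun _ : ↥(S ∩ Q) => E) ⊤ →L[ℝ] E, ‖iteratedDeriv n (F (fun X => ℓ (G X))) ψ‖ ≤ ‖ℓ‖ * B)
    (g' : P → M → E) (hg : ∀ q ∈ S ∩ Q, ContDiff ℝ ∞ (g' q)) {C : Set M} (hC : IsCompact C) (hsupp : ∀ q ∈ S ∩ Q, tsupport (g' q) ⊆ C)
    (hbd : ∀ m : ℕ, ∃ B : ℝ, ∀ q ∈ S ∩ Q, ∀ X ∈ C, ‖iteratedFDeriv ℝ m (g' q) X‖ ≤ B) :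
    ∃ B : ℝ, ∀ q ∈ S ∩ Q, ∀ ψ ∈ T₀, ‖iteratedDeriv n (F (g' q)) ψ‖ ≤ B := by
  obtain ⟨B, hB⟩ := exists_forall_norm_iteratedDeriv_le_of_uniform_bounds_on (J := ↥(S ∩ Q)) F n T₀ hunif (fun y => g' y.1) (fun y => hg y.1 y.2) hC
    (fun y => hsupp y.1 y.2) (fun m => by obtain ⟨B, hB⟩ := hbd m; exact ⟨B, fun y X hX => hB y.1 y.2 X hX⟩)
  exact ⟨B, fun q hq ψ hψ => hB ⟨q, hq⟩ ψ hψ⟩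

/-- **The `S ∩ Q`-indexed eventual form.** [cite: HormanderALPDO1, §2.1] [cite: Bouaziz1994IntegralesOrbitales, §3.1 (I₁)–(I₂) p. 579] -/
theorem exists_forall_eventually_norm_iteratedDeriv_le_of_uniform_bounds_on_inter {P : Type} (F : (M → E) → ℝ → E) (n : ℕ) (S Q : Set P)
    (hunif : ∀ G : M → lp (fun _ : ↥(S ∩ Q) => E) ⊤, ContDiff ℝ ∞ G → HasCompactSupport G →
      ∃ B : ℝ, ∀ᶠ ψ in 𝓝[≠] (0 : ℝ), ∀ ℓ : lp (fun _ : ↥(S ∩ Q) => E) ⊤ →L[ℝ] E, ‖iteratedDeriv n (F (fun X => ℓ (G X))) ψ‖ ≤ ‖ℓ‖ * B)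
    (g' : P → M → E) (hg : ∀ q ∈ S ∩ Q, ContDiff ℝ ∞ (g' q)) {C : Set M} (hC : IsCompact C) (hsupp : ∀ q ∈ S ∩ Q, tsupport (g' q) ⊆ C)
    (hbd : ∀ m : ℕ, ∃ B : ℝ, ∀ q ∈ S ∩ Q, ∀ X ∈ C, ‖iteratedFDeriv ℝ m (g' q) X‖ ≤ B) :
    ∃ B : ℝ, ∀ᶠ ψ in 𝓝[≠] (0 : ℝ), ∀ q ∈ S ∩ Q, ‖iteratedDeriv n (F (g' q)) ψ‖ ≤ B := by
  obtain ⟨B, hB⟩ := exists_forall_eventually_norm_iteratedDeriv_le_of_uniform_bounds (J := ↥(S ∩ Q)) F n hunif (fun y => g' y.1) (fun y => hg y.1 y.2) hC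
    (fun y => hsupp y.1 y.2) (fun m => by obtain ⟨B, hB⟩ := hbd m; exact ⟨B, fun y X hX => hB y.1 y.2 X hX⟩)
  exact ⟨B, by filter_upwards [hB] with ψ hψ q hq; exact hψ ⟨q, hq⟩⟩

end BoundedFamily

/-! ## §3 Slices of a jointly bounded function: the `C^∞`-bounded family of the next peeling step -/

section Slices

variable {P M F : Type*} [NormedAddCommGroup P] [NormedSpace ℝ P] [NormedAddCommGroup M] [NormedSpace ℝ M] [NormedAddCommGroup F] [NormedSpace ℝ F]

/-- **The partial jet of a slice is bounded by the full jet**: for `R` of class `Cᵐ` on an open `O ⊆ P × M` and `(q, X) ∈ O`, `‖Dᵐ (X′ ↦ R (q, X′)) X‖ ≤ ‖Dᵐ R (q, X)‖` (the slice is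
`R ∘ (· + (q, 0)) ∘ inr`; ★ (B2) §1 `norm_iteratedFDeriv_comp_clm_le_of_isOpen` along the CLM `inr` of norm `≤ 1`, Mathlib `iteratedFDeriv_comp_add_right` for the translation).
[cite: HormanderALPDO1, §1.1 (1.1.8)] -/
theorem norm_iteratedFDeriv_slice_le_of_isOpen (R : P × M → F) {O : Set (P × M)} (hO : IsOpen O) {m : ℕ} (hR : ContDiffOn ℝ m R O) {q : P} {X : M} (h : (q, X) ∈ O) :
    ‖iteratedFDeriv ℝ m (fun X' : M => R (q, X')) X‖ ≤ ‖iteratedFDeriv ℝ m R (q, X)‖ := by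
  -- the translated function and the open preimage
  set Rq : P × M → F := fun z => R (z + (q, 0)) with hRq
  have hpre : IsOpen ((fun z : P × M => z + (q, 0)) ⁻¹' O) := hO.preimage (continuous_id.add continuous_const)
  have hRqs : ContDiffOn ℝ m Rq ((fun z : P × M => z + (q, 0)) ⁻¹' O) := hR.comp (contDiff_id.add contDiff_const).contDiffOn fun z hz => hz
  have hslice : (fun X' : M => R (q, X')) = Rq ∘ (ContinuousLinearMap.inr ℝ P M) := by
    funext X'
    simp only [hRq, comp_apply, ContinuousLinearMap.inr_apply, Prod.mk_add_mk, zero_add, add_zero]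
  have hX : (ContinuousLinearMap.inr ℝ P M) X ∈ (fun z : P × M => z + (q, 0)) ⁻¹' O := by
    simp only [mem_preimage, ContinuousLinearMap.inr_apply, Prod.mk_add_mk, zero_add, add_zero]; exact h
  rw [hslice]
  refine (norm_iteratedFDeriv_comp_clm_le_of_isOpen (ContinuousLinearMap.inr ℝ P M) hpre hRqs hX).trans ?_
  have htr : iteratedFDeriv ℝ m Rq ((ContinuousLinearMap.inr ℝ P M) X) = iteratedFDeriv ℝ m R (q, X) := by
    rw [hRq, iteratedFDeriv_comp_add_right m (q, (0 : M)) ((ContinuousLinearMap.inr ℝ P M) X)]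
    simp only [ContinuousLinearMap.inr_apply, Prod.mk_add_mk, zero_add, add_zero]
  rw [htr]
  have hn : ‖ContinuousLinearMap.inr ℝ P M‖ ≤ 1 := ContinuousLinearMap.opNorm_le_bound _ zero_le_one fun x => by
    rw [one_mul, ContinuousLinearMap.inr_apply, Prod.norm_mk, norm_zero, max_eq_right (norm_nonneg x)]
  calc ‖ContinuousLinearMap.inr ℝ P M‖ ^ m * ‖iteratedFDeriv ℝ m R (q, X)‖ ≤ 1 ^ m * ‖iteratedFDeriv ℝ m R (q, X)‖ := by
        gcongr
    _ = ‖iteratedFDeriv ℝ m R (q, X)‖ := by rw [one_pow, one_mul]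

/-- **Slices of a jointly bounded function form a `C^∞`-bounded family**: if the jets of `R` (smooth on the open `O ⊇ S ×ˢ C`) of every order are bounded on `S ×ˢ C`, then the slices
`{X ↦ R (s, X)}_{s ∈ S}` have jets of every order bounded on `C` uniformly in `s` — the `hbd` input of §2. [cite: HormanderALPDO1, §1.1 (1.1.8); §2.1] -/
theorem exists_forall_slice_bounds_of_bddAbove (R : P × M → F) {O : Set (P × M)} (hO : IsOpen O) (hR : ContDiffOn ℝ ∞ R O) (S : Set P) (C : Set M) (hSC : S ×ˢ C ⊆ O)
    (hb : ∀ m : ℕ, BddAbove ((fun z => ‖iteratedFDeriv ℝ m R z‖) '' (S ×ˢ C))) (m : ℕ) :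
    ∃ B : ℝ, ∀ s ∈ S, ∀ X ∈ C, ‖iteratedFDeriv ℝ m (fun X' : M => R (s, X')) X‖ ≤ B := by
  obtain ⟨B, hB⟩ := hb m
  exact ⟨B, fun s hs X hX => (norm_iteratedFDeriv_slice_le_of_isOpen R hO (hR.of_le (mod_cast le_top)) (hSC (mk_mem_prod hs hX))).trans
    (hB ⟨(s, X), mk_mem_prod hs hX, rfl⟩)⟩

/-- **A slice of a function smooth on `Q ×ˢ univ` is smooth** (`q ∈ Q`). [cite: HormanderALPDO1, §1.1 (1.1.8)] -/
theorem contDiff_slice_of_contDiffOn_prod_univ (R : P × M → F) {Q : Set P} (hR : ContDiffOn ℝ ∞ R (Q ×ˢ (univ : Set M))) {q : P} (hq : q ∈ Q) :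
    ContDiff ℝ ∞ fun X : M => R (q, X) := by
  have hmaps : MapsTo (fun X : M => ((q, X) : P × M)) univ (Q ×ˢ (univ : Set M)) := fun X _ => mk_mem_prod hq (mem_univ X)
  have h : ContDiffOn ℝ ∞ (fun X : M => R (q, X)) univ := hR.comp (contDiff_const.prodMk contDiff_id).contDiffOn hmaps
  exact contDiffOn_univ.1 h

omit [NormedAddCommGroup P] [NormedSpace ℝ P] [NormedSpace ℝ M] [NormedSpace ℝ F] in
/-- **Uniform compact support of the slices**: if `R (s, X) = 0` for `X ∉ C` with `C` closed, then `tsupport (X ↦ R (s, X)) ⊆ C`. [cite: HormanderALPDO1, §2.1] -/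
theorem tsupport_slice_subset (R : P × M → F) {C : Set M} (hC : IsClosed C) {s : P} (h0 : ∀ X, X ∉ C → R (s, X) = 0) :
    tsupport (fun X : M => R (s, X)) ⊆ C :=
  closure_minimal (fun X hX => by
    by_contra hXC
    exact hX (h0 X hXC)) hC

end Slices

/-! ## §4 The punctured-interval upgrade: an eventual bound at the wall + continuity on the punctured compact interval ⇒ a bound on the whole punctured interval -/

section Upgrade

variable {E E' : Type*} [NormedAddCommGroup E] [NormedSpace ℝ E] [NormedAddCommGroup E'] [NormedSpace ℝ E']

omit [NormedSpace ℝ E] in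
/-- **From an eventual bound at `ψ = 0` to a bound on a whole punctured compact set**: `u` continuous on `T₀ ∖ {0}` (`T₀` compact) and bounded on a punctured neighbourhood of `0`
⇒ bounded on `T₀ ∖ {0}` (outside the punctured ball `T₀` is compact and `u` continuous there). [cite: Bouaziz1994IntegralesOrbitales, §3.1 (I₂) p. 579] -/
theorem exists_forall_norm_le_of_eventually_of_continuousOn {u : ℝ → E} {T₀ : Set ℝ} (hT₀ : IsCompact T₀) (hu : ContinuousOn u (T₀ ∩ {0}ᶜ))
    (hev : ∃ B : ℝ, ∀ᶠ ψ in 𝓝[≠] (0 : ℝ), ‖u ψ‖ ≤ B) : ∃ B : ℝ, ∀ ψ ∈ T₀ ∩ {0}ᶜ, ‖u ψ‖ ≤ B := by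
  obtain ⟨B, hB⟩ := hev
  rw [eventually_nhdsWithin_iff, Metric.eventually_nhds_iff] at hB
  obtain ⟨ε, hε, hεB⟩ := hB
  -- the far part `T₀ ∖ ball 0 ε` is compact and inside `T₀ ∖ {0}`
  have hfar : IsCompact (T₀ \ Metric.ball (0 : ℝ) ε) := hT₀.diff Metric.isOpen_ball
  have hsub : T₀ \ Metric.ball (0 : ℝ) ε ⊆ T₀ ∩ {0}ᶜ := fun ψ hψ => ⟨hψ.1, fun h0 => hψ.2 (by rw [mem_singleton_iff] at h0; rw [h0]; exact Metric.mem_ball_self hε)⟩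
  obtain ⟨B', hB'⟩ := hfar.exists_bound_of_continuousOn ((hu.mono hsub).norm)
  refine ⟨max B B', fun ψ hψ => ?_⟩
  by_cases hψε : ψ ∈ Metric.ball (0 : ℝ) ε
  · exact (hεB hψε hψ.2).trans (le_max_left _ _)
  · have h := hB' ψ ⟨hψ.1, hψε⟩
    rw [Real.norm_eq_abs, abs_norm] at h
    exact h.trans (le_max_right _ _)

/-- **The CLM-uniform form**: if `u ψ ℓ = ℓ (u′ ψ)` factors through CLMs `ℓ : E′ →L E` on `T₀ ∖ {0}`, with `u′` continuous on `T₀ ∖ {0}` (`T₀` compact), and an eventual CLM-uniform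
bound `‖u ψ ℓ‖ ≤ ‖ℓ‖ · B` holds near `0`, then ONE `B′` gives `‖u ψ ℓ‖ ≤ ‖ℓ‖ · B′` for all `ψ ∈ T₀ ∖ {0}` and all `ℓ` (outside the punctured ball bound `‖u′‖` by compactness) — the step
turning ★ (ELL-∞-UNIF) §4 (eventual) + ★ §2∕§3 (`(F (ℓ ∘ G))⁽ⁿ⁾ = ℓ ∘ (F′ G)⁽ⁿ⁾`, smooth on the punctured interval) into the fixed-interval `hunif` of §2.
[cite: Bouaziz1994IntegralesOrbitales, §3.1 (I₂) p. 579] [cite: Varadarajan1977, Part I §1.12] -/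
theorem exists_forall_norm_comp_clm_le_of_eventually_of_continuousOn (u : ℝ → (E' →L[ℝ] E) → E) (u' : ℝ → E') {T₀ : Set ℝ} (hT₀ : IsCompact T₀)
    (hu' : ContinuousOn u' (T₀ ∩ {0}ᶜ)) (hfac : ∀ ψ ∈ T₀ ∩ {0}ᶜ, ∀ ℓ : E' →L[ℝ] E, u ψ ℓ = ℓ (u' ψ))
    (hev : ∃ B : ℝ, ∀ᶠ ψ in 𝓝[≠] (0 : ℝ), ∀ ℓ : E' →L[ℝ] E, ‖u ψ ℓ‖ ≤ ‖ℓ‖ * B) :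
    ∃ B : ℝ, ∀ ψ ∈ T₀ ∩ {0}ᶜ, ∀ ℓ : E' →L[ℝ] E, ‖u ψ ℓ‖ ≤ ‖ℓ‖ * B := by
  obtain ⟨B, hB⟩ := hev
  rw [eventually_nhdsWithin_iff, Metric.eventually_nhds_iff] at hB
  obtain ⟨ε, hε, hεB⟩ := hB
  have hfar : IsCompact (T₀ \ Metric.ball (0 : ℝ) ε) := hT₀.diff Metric.isOpen_ball
  have hsub : T₀ \ Metric.ball (0 : ℝ) ε ⊆ T₀ ∩ {0}ᶜ := fun ψ hψ => ⟨hψ.1, fun h0 => hψ.2 (by rw [mem_singleton_iff] at h0; rw [h0]; exact Metric.mem_ball_self hε)⟩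
  obtain ⟨B', hB'⟩ := hfar.exists_bound_of_continuousOn ((hu'.mono hsub).norm)
  refine ⟨max B (max B' 0), fun ψ hψ ℓ => ?_⟩
  by_cases hψε : ψ ∈ Metric.ball (0 : ℝ) ε
  · exact (hεB hψε hψ.2 ℓ).trans (mul_le_mul_of_nonneg_left (le_max_left _ _) (norm_nonneg ℓ))
  · have h := hB' ψ ⟨hψ.1, hψε⟩
    rw [Real.norm_eq_abs, abs_norm] at h
    rw [hfac ψ hψ ℓ]
    calc ‖ℓ (u' ψ)‖ ≤ ‖ℓ‖ * ‖u' ψ‖ := ℓ.le_opNorm _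
      _ ≤ ‖ℓ‖ * max B (max B' 0) := mul_le_mul_of_nonneg_left (h.trans ((le_max_left _ _).trans (le_max_right _ _))) (norm_nonneg ℓ)

end Upgrade

/-! ## ED. 2 (append-only) — §2 ∘ §3 in one call: the `hbd` of a reader family from JOINT jet bounds of the uncurried family -/

section JointBounds

variable {M E : Type} [NormedAddCommGroup M] [NormedSpace ℝ M] [NormedAddCommGroup E] [NormedSpace ℝ E]

/-- **THE `hbd` OF ★ `exists_forall_norm_iteratedFDeriv_lineReader_le_of_uniform_on` FROM JOINT JET BOUNDS (§2 ∘ §3 packaged; ED. 2).**  A parameter family `g′ : P → M → E` smooth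
on `Q ×ˢ univ` (`Q` open), supported in one compact `C` over `Q`, whose UNCURRIED jets of every order are bounded on `(S ∩ Q) ×ˢ univ` — the admissible class of the corner peeling
(★ `contDiffOn_and_forall_bound_nestedReader`) — has `C^∞`-bounded members (§3 slices), so a functional `F` with the (ELL-∞-UNIF)-type hypothesis on `T₀` at `E′ := ℓ^∞(↥(S ∩ Q), E)`
bounds the normal jets `(F (g′ q))⁽ⁿ⁾ ψ` uniformly over `q ∈ S ∩ Q`, `ψ ∈ T₀` (§2).  This is the one-call supplier used inside the peeling step; recorded for the corner consumers
((X3-rk1) F0P3a-p04, (E4′) F0P3a-p08). [cite: HormanderALPDO1, §1.1 (1.1.8); §2.1] [cite: Bouaziz1994IntegralesOrbitales, §3.1 (I₁)–(I₂) p. 579] -/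
theorem exists_forall_norm_iteratedDeriv_le_of_jointBounds {P : Type} [NormedAddCommGroup P] [NormedSpace ℝ P] (F : (M → E) → ℝ → E) (n : ℕ) (S : Set P) {Q : Set P}
    (hQ : IsOpen Q) (T₀ : Set ℝ)
    (hunif : ∀ G : M → lp (fun _ : ↥(S ∩ Q) => E) ⊤, ContDiff ℝ ∞ G → HasCompactSupport G →
      ∃ B : ℝ, ∀ ψ ∈ T₀, ∀ ℓ : lp (fun _ : ↥(S ∩ Q) => E) ⊤ →L[ℝ] E, ‖iteratedDeriv n (F (fun X => ℓ (G X))) ψ‖ ≤ ‖ℓ‖ * B)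
    (g' : P → M → E) (hg : ContDiffOn ℝ ∞ (uncurry g') (Q ×ˢ univ)) {C : Set M} (hC : IsCompact C) (h0 : ∀ q ∈ Q, ∀ X, X ∉ C → g' q X = 0)
    (hjb : ∀ m : ℕ, ∃ B : ℝ, ∀ q ∈ S ∩ Q, ∀ X : M, ‖iteratedFDeriv ℝ m (uncurry g') (q, X)‖ ≤ B) :
    ∃ B : ℝ, ∀ q ∈ S ∩ Q, ∀ ψ ∈ T₀, ‖iteratedDeriv n (F (g' q)) ψ‖ ≤ B :=
  exists_forall_norm_iteratedDeriv_le_of_uniform_bounds_on_inter F n S Q T₀ hunif g'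
    (fun q hq => contDiff_slice_of_contDiffOn_prod_univ (uncurry g') hg hq.2) hC
    (fun q hq => tsupport_slice_subset (uncurry g') hC.isClosed fun X hX => h0 q hq.2 X hX)
    fun m => by
      obtain ⟨B, hB⟩ := hjb m
      exact ⟨B, fun q hq X _ => (norm_iteratedFDeriv_slice_le_of_isOpen (uncurry g') (hQ.prod isOpen_univ) (hg.of_le (mod_cast le_top))
        ⟨hq.2, mem_univ X⟩).trans (hB q hq X)⟩

end JointBounds

end Literature.Analysis.Calculus

end
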